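/-
Copyright (c) 2026 the pub-hodgecm-mathlib formalisation cell (harness21).  Prover seat hodgecm-mathlib-F0P2-p08 (g3), Track B «K2-LIT»,
#184♮ = hLiu418 = `stmt-HodgeConjecture-24832`; socket #41 `sig_K2LiuSiegelEisensteinContinuation`, KIND W, brick (x-a-int-fac): the per-factor letters `hsec`, `hsm` of
★ (iii-fin-int) ∕ ★ (x-a-int) for the (KW-fac) READING of the local factors `FvT`, and the joint `hint` letter of ★ ED. 4 from `hintArch` alone.
THEOREMS ONLY (no `def`, no `instance`, no notation, no named-fact hypothesis, no `sorry`).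
-/
import Summits.HodgeConjecture.HodgeConjecture.Theorems.K2LiuKindWJointIntegrable            -- ★ (x-a-int) `hint_of_isLocalSiegelSection_joint` (⊇ ★ (iii-fin-int))
import Summits.HodgeConjecture.HodgeConjecture.Theorems.K2LiuKindWFactorizableDecomposition  -- ★ (KW-fac) `exists_kindW_factorization` (the reading of `FvT`; brings `modDelta`, `IwasawaDatum.pPart`)
import Literature.NumberTheory.K2Lit.LocalDoublingSiegel                                    -- ★ `lambdaLoc_mem_localDegPS`
import HarnessLib

/-!
# Crux `HLiu418`, socket #41, KIND W — brick (x-a-int-fac) `K2LiuKindWFactorLetters`: THE (KW-fac) LOCAL FACTORS ARE SMOOTH LOCAL SIEGEL SECTIONS,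
# so ★ (iii-fin-int) ∕ ★ (x-a-int) apply — the joint `hint` letter of ★ ED. 4 for the standard family's Σ⊗ reading, from the archimedean letter alone

Cell `hodgecm-mathlib`, crux item hLiu418 = `stmt-HodgeConjecture-24832` (helper lane `--supports … --as helper`, count-neutral), route of record
`HCCMUnconditional`; squad K2 ∕ K2Liu, road `K2_Liu`, socket #41, KIND W; KW desk of record F0P2-p08 (g3).  ★ (KW-fac) p863379
`K2LiuKindWFactorizableDecomposition.exists_kindW_factorization` presents a standard family `f` off `S₀` as `Σ_i (H_∞^{2(s−s₀)}·A_i) ⊗ ∏_v FvT`, with the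
LOCAL READING (its §3): `FvT j S h v s y := if v ∈ S₀ then H_v(y)^{2(s−s₀)}·b_{j,v}(y) else Λ_{s,v}(y)`, and exports the per-factor letter «the flat twist
`H_v^{2(s−s₀)}·b_{j,v}` lies in `I_v(s, χ_v) = localDegPS … s` for EVERY `s`» (★ (E6′) `heightTwistLoc_mem_localDegPS`) together with «`χ` unramified above every `v ∉ S₀`».
THIS FILE reads those two letters into the hypotheses `hsec` (`IsLocalSiegelSection`) and `hsm` (`IsSmooth`) of ★ (iii-fin-int) `hint_of_isLocalSiegelSection` ∕ ★ (x-a-int)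
`hint_of_isLocalSiegelSection_joint` (the `else` branch by ★ `lambdaLoc_mem_localDegPS`; membership is ★ `mem_localDegPS_iff`, definitional), for ANY `FvT` with that
reading (hypothesis `hread`, pointwise — the tie passes its own `FvT` and `fun … => rfl`):
* §1 **`kindWFvT_mem_localDegPS`** — `FvT j S h v s ∈ I_v(s, χ_v)`; **`hsec_of_reading`**, **`hsm_of_reading`** — the two letters in ★ (iii-fin-int)'s binder bytes.
* §2 **`hint_joint_of_reading`** — ★ ED. 4's JOINT `hint` (`n := 2`) for such `FvT` from `hintArch` ALONE (+ `hχu`, Haar carriers): ★ (x-a-int) ∘ §1.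
[Tan1999, §1 p. 166, §3] [KudlaRallis1994, §1] [HarrisKudlaSweet1996, §1 (1.15)–(1.17)] [Casselman1980, §3].
HONEST LABEL.  Count-neutral helper; closes no socket by itself: `HC_CM` is proved only modulo the 7 printed citations (2 remaining named inputs:
hLiu418 = `stmt-HodgeConjecture-24832`, h413 = `stmt-HodgeConjecture-24833`) until rung 0 closes.  NOT HERE (by value): the archimedean factor letter `hintArch`
(K2Liu-p11 `K2LiuKindWArchLetterIntegrable`).

## References
* [Tan1999] V. Tan, *Poles of Siegel Eisenstein series on U(n,n)*, Canad. J. Math. 51 (1999): §1 p. 166, §3.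
* [KudlaRallis1994] S. Kudla, S. Rallis, Ann. of Math. 140 (1994): §1.   * [HarrisKudlaSweet1996] M. Harris, S. Kudla, W. J. Sweet, J. AMS 9 (1996): §1 (1.15)–(1.17).
* [Casselman1980] W. Casselman, Compositio Math. 40 (1980): §3.
-/

set_option autoImplicit false
-- the mandated namespace repeats the single-problem summit's segment (`HodgeConjecture.HodgeConjecture`)
set_option linter.dupNamespace false

noncomputable section

open scoped Matrix ComplexConjugate NNReal ENNReal BigOperators
open NumberField IsDedekindDomain Matrix MeasureTheory Measure Set
open Literature.NumberTheory.Automorphic hiding IsKFinite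
open Literature.NumberTheory.Automorphic.UnitaryGroup Literature.NumberTheory.GaloisRepresentations
open Literature.NumberTheory.LFunctions
open Literature.NumberTheory.GelbartRogawski1991 Literature.NumberTheory.GelbartRogawski1991.GRConstruction
open Literature.NumberTheory.GelbartRogawski1991.UnitaryDualPair
open Literature.NumberTheory.K2Lit Literature.NumberTheory.K2Lit.SiegelDoubled Literature.NumberTheory.K2Lit.LocalSiegelDoubled Literature.NumberTheory.K2Lit.PlaceSplitting
open Summit.HodgeConjecture.HodgeConjecture.Cruxes.HLiu418.K2LiuSiegelUnipotentFourierDefs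
open Summit.HodgeConjecture.HodgeConjecture.Cruxes.HLiu418.K2LiuSiegelUnipotentLocalDefs
open Summit.HodgeConjecture.HodgeConjecture.Cruxes.HLiu418.K2LiuSiegelUnipotentSplitDefs
open Summit.HodgeConjecture.HodgeConjecture.Cruxes.HLiu418.K2LiuSiegelEisensteinKindWLetters
open Summit.HodgeConjecture.HodgeConjecture.Cruxes.HLiu418.K2LiuKindWJointIntegrable (hint_of_isLocalSiegelSection_joint)

namespace Summit.HodgeConjecture.HodgeConjecture.Cruxes.HLiu418.K2LiuKindWFactorLetters

variable (L : Type) [Field L] [NumberField L] [IsCMField L]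
variable {N M : ℕ} (e : Fin N × Fin M ≃ Fin 2)
  (dV : Fin N → L) (hdV : ∀ i, IsCMField.complexConj L (dV i) = dV i)
  (dW : Fin M → L) (hdW : ∀ i, IsCMField.complexConj L (dW i) = dW i)
  (hdV0 : ∀ i, dV i ≠ 0) (hdW0 : ∀ i, dW i ≠ 0)

/-! ## §1 The local factors of the (KW-fac) reading lie in `I_v(s, χ_v)` -/

section Reading

variable [DecidableEq (HeightOneSpectrum (𝓞 (Fp L)))] (𝒦 : IwasawaDatum L e dV hdV dW hdW) {χ : HeckeCharacter L} (s₀ : ℂ)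
  {S₀ T₀ : Finset (HeightOneSpectrum (𝓞 (Fp L)))} (hχS₀ : ∀ v, v ∉ S₀ → ∀ w : UnitaryGroup.PlacesOver L v, χ.IsUnramifiedAt w.1)
  {m : ℕ} (b : Fin m → (v : HeightOneSpectrum (𝓞 (Fp L))) → (UnitaryGroup.localPi L (IsCMField.complexConj L) (2 + 2) (hermD L e dV hdV dW hdW) v → ℂ))
  (hb : ∀ i, ∀ v ∈ S₀, ∀ s : ℂ, (fun u => ((modDelta L e dV hdV dW hdW (𝒦.pPart (locToAdelic L e dV hdV dW hdW v u)) : ℝ) : ℂ) ^ (2 * (s - s₀)) * b i v u) ∈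
    localDegPS (Fp L) L (IsCMField.complexConj L) (complexConj_imagUnit L) (imagUnit_ne_zero L) (imagUnit_mul_self L)
      v 2 (gramR_isSymm L e dV hdV dW hdW) (hermD_eq_map_gramD L e dV hdV dW hdW) (fun w => χ.localComponent w.1) s)
  (FvT : Fin m → ∀ (S : skewMatrices ((IsCMField.complexConj L : L ≃ₐ[Fp L] L) : L →+* L) ((gramR L e dV hdV dW hdW).map (algebraMap (Fp L) L)))
    (h : HA L e dV hdV dW hdW) (v : (kindWFinset L e dV hdV dW hdW T₀ (S : Matrix (Fin 2) (Fin 2) L) h)),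
    ℂ → UnitaryGroup.localPi L (IsCMField.complexConj L) (2 + 2) (hermD L e dV hdV dW hdW) v.1 → ℂ)
  (hread : ∀ (j : Fin m) (S : skewMatrices ((IsCMField.complexConj L : L ≃ₐ[Fp L] L) : L →+* L) ((gramR L e dV hdV dW hdW).map (algebraMap (Fp L) L)))
    (h : HA L e dV hdV dW hdW) (v : (kindWFinset L e dV hdV dW hdW T₀ (S : Matrix (Fin 2) (Fin 2) L) h)) (s : ℂ)
    (y : UnitaryGroup.localPi L (IsCMField.complexConj L) (2 + 2) (hermD L e dV hdV dW hdW) v.1),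
    FvT j S h v s y = if v.1 ∈ S₀ then ((modDelta L e dV hdV dW hdW (𝒦.pPart (locToAdelic L e dV hdV dW hdW v.1 y)) : ℝ) : ℂ) ^ (2 * (s - s₀)) * b j v.1 y
      else LambdaLoc L e dV hdV dW hdW v.1 χ s y)

include hχS₀ hb hread in
/-- **each local factor of the (KW-fac) reading lies in `I_v(s, χ_v)`**: above `S₀` it is the flat twist of `b_{j,v}` (★ (KW-fac)'s per-factor letter, ★ (E6′)
`heightTwistLoc_mem_localDegPS`); off `S₀` it is the unramified section `Λ_{s,v}` (★ `lambdaLoc_mem_localDegPS`, `χ` unramified above `v`).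
[cite: Tan1999, §1 p. 166] [cite: HarrisKudlaSweet1996, §1 (1.15)] -/
theorem kindWFvT_mem_localDegPS (j : Fin m) (S : skewMatrices ((IsCMField.complexConj L : L ≃ₐ[Fp L] L) : L →+* L) ((gramR L e dV hdV dW hdW).map (algebraMap (Fp L) L)))
    (h : HA L e dV hdV dW hdW) (v : (kindWFinset L e dV hdV dW hdW T₀ (S : Matrix (Fin 2) (Fin 2) L) h)) (s : ℂ) :
    FvT j S h v s ∈ localDegPS (Fp L) L (IsCMField.complexConj L) (complexConj_imagUnit L) (imagUnit_ne_zero L) (imagUnit_mul_self L)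
      v.1 2 (gramR_isSymm L e dV hdV dW hdW) (hermD_eq_map_gramD L e dV hdV dW hdW) (fun w => χ.localComponent w.1) s := by
  have hfun : FvT j S h v s = fun y => if v.1 ∈ S₀ then ((modDelta L e dV hdV dW hdW (𝒦.pPart (locToAdelic L e dV hdV dW hdW v.1 y)) : ℝ) : ℂ) ^ (2 * (s - s₀)) * b j v.1 y
      else LambdaLoc L e dV hdV dW hdW v.1 χ s y := funext (hread j S h v s)
  by_cases hv : v.1 ∈ S₀
  · simp only [hv, if_true] at hfun
    rw [hfun]
    exact hb j v.1 hv s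
  · simp only [hv, if_false] at hfun
    have hΛ : FvT j S h v s = LambdaLoc L e dV hdV dW hdW v.1 χ s := hfun
    rw [hΛ]
    exact lambdaLoc_mem_localDegPS L e dV hdV dW hdW v.1 χ s (hχS₀ v.1 hv)

include hχS₀ hb hread in
/-- **the letter `hsec` of ★ (iii-fin-int) ∕ ★ (x-a-int) for the (KW-fac) reading** (first component of ★ `mem_localDegPS_iff`). [cite: HarrisKudlaSweet1996, §1 (1.15)] -/
theorem hsec_of_reading :
    ∀ (j : Fin m) (S : skewMatrices ((IsCMField.complexConj L : L ≃ₐ[Fp L] L) : L →+* L) ((gramR L e dV hdV dW hdW).map (algebraMap (Fp L) L)))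
      (h : HA L e dV hdV dW hdW) (v : (kindWFinset L e dV hdV dW hdW T₀ (S : Matrix (Fin 2) (Fin 2) L) h)) (s : ℂ), ((2 : ℕ) : ℝ) / 2 < s.re → (S : Matrix (Fin 2) (Fin 2) L).det ≠ 0 →
      IsLocalSiegelSection (Fp L) L (IsCMField.complexConj L) (complexConj_imagUnit L) (imagUnit_ne_zero L) (imagUnit_mul_self L) v.1 2
        (gramR_isSymm L e dV hdV dW hdW) (hermD_eq_map_gramD L e dV hdV dW hdW) (fun w => χ.localComponent w.1) s (FvT j S h v s) :=
  fun j S h v s _ _ => ((mem_localDegPS_iff (Fp L) L (IsCMField.complexConj L) (complexConj_imagUnit L) (imagUnit_ne_zero L) (imagUnit_mul_self L) v.1 2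
    (gramR_isSymm L e dV hdV dW hdW) (hermD_eq_map_gramD L e dV hdV dW hdW) _ s _).1 (kindWFvT_mem_localDegPS L e dV hdV dW hdW 𝒦 s₀ hχS₀ b hb FvT hread j S h v s)).1

include hχS₀ hb hread in
/-- **the letter `hsm` of ★ (iii-fin-int) ∕ ★ (x-a-int) for the (KW-fac) reading** (second component of ★ `mem_localDegPS_iff`). [cite: HarrisKudlaSweet1996, §1 (1.15)] -/
theorem hsm_of_reading :
    ∀ (j : Fin m) (S : skewMatrices ((IsCMField.complexConj L : L ≃ₐ[Fp L] L) : L →+* L) ((gramR L e dV hdV dW hdW).map (algebraMap (Fp L) L)))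
      (h : HA L e dV hdV dW hdW) (v : (kindWFinset L e dV hdV dW hdW T₀ (S : Matrix (Fin 2) (Fin 2) L) h)) (s : ℂ), ((2 : ℕ) : ℝ) / 2 < s.re → (S : Matrix (Fin 2) (Fin 2) L).det ≠ 0 →
      IsSmooth (Fp L) L (IsCMField.complexConj L) v.1 2 (JD := hermD L e dV hdV dW hdW) (FvT j S h v s) :=
  fun j S h v s _ _ => ((mem_localDegPS_iff (Fp L) L (IsCMField.complexConj L) (complexConj_imagUnit L) (imagUnit_ne_zero L) (imagUnit_mul_self L) v.1 2
    (gramR_isSymm L e dV hdV dW hdW) (hermD_eq_map_gramD L e dV hdV dW hdW) _ s _).1 (kindWFvT_mem_localDegPS L e dV hdV dW hdW 𝒦 s₀ hχS₀ b hb FvT hread j S h v s)).2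

end Reading

/-! ## §2 The joint letter `hint` of ★ ED. 4 for the (KW-fac) reading, from the archimedean letter alone -/

section Joint

variable [DecidableEq (HeightOneSpectrum (𝓞 (Fp L)))]
  [MeasurableSpace ↥(unipDeltaArch L e dV hdV dW hdW)]
  [∀ v : HeightOneSpectrum (𝓞 (Fp L)), MeasurableSpace ↥(unipDeltaLoc L e dV hdV dW hdW v)]
  [∀ v : HeightOneSpectrum (𝓞 (Fp L)), BorelSpace ↥(unipDeltaLoc L e dV hdV dW hdW v)]

include hdV0 hdW0 in
/-- **THE JOINT LETTER `hint` OF ★ (x-a) ED. 4 (`n := 2`) FOR THE (KW-fac) READING OF THE LOCAL FACTORS, FROM THE ARCHIMEDEAN FACTOR LETTER ALONE.**  Inputs: Haar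
carriers `νv` (σ-finite), `χ` unitary (`hχu`), the Iwasawa datum `𝒦` and abscissa `s₀` of the (KW-fac) presentation with its two exported letters — `hχS₀` (`χ`
unramified above every `v ∉ S₀`) and `hb` (each flat twist `H_v^{2(s−s₀)}·b_{j,v}` lies in `I_v(s,χ_v)`) —, any `FvT` with the (KW-fac) reading (`hread`), and the
archimedean factor letter `hintArch` (★ K2Liu-p11 `hintArch_of_kindWArchLetter` pays it from a flat product presentation of `FinfT`).  THEN ★ ED. 4's `hint` VERBATIM
(★ (x-a-int) `hint_of_isLocalSiegelSection_joint` ∘ §1). [cite: KudlaRallis1994, §1] [cite: Tan1999, §3] [cite: HarrisKudlaSweet1996, §1 (1.15)–(1.17)] -/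
theorem hint_joint_of_reading (T₀ : Finset (HeightOneSpectrum (𝓞 (Fp L))))
    (νinf : Finset (HeightOneSpectrum (𝓞 (Fp L))) → Measure ↥(unipDeltaArch L e dV hdV dW hdW))
    (νv : ∀ v : HeightOneSpectrum (𝓞 (Fp L)), Measure ↥(unipDeltaLoc L e dV hdV dW hdW v)) [∀ v, (νv v).IsHaarMeasure] [∀ v, SigmaFinite (νv v)]
    {χ : HeckeCharacter L} (hχu : χ.IsUnitary) (𝒦 : IwasawaDatum L e dV hdV dW hdW) (s₀ : ℂ)
    {S₀ : Finset (HeightOneSpectrum (𝓞 (Fp L)))} (hχS₀ : ∀ v, v ∉ S₀ → ∀ w : UnitaryGroup.PlacesOver L v, χ.IsUnramifiedAt w.1) {m : ℕ}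
    (FinfT : Fin m → skewMatrices ((IsCMField.complexConj L : L ≃ₐ[Fp L] L) : L →+* L) ((gramR L e dV hdV dW hdW).map (algebraMap (Fp L) L)) → HA L e dV hdV dW hdW → ℂ →
      UnitaryGroup.arch (Fp L) L (IsCMField.complexConj L) (2 + 2) (hermD L e dV hdV dW hdW) → ℂ)
    (b : Fin m → (v : HeightOneSpectrum (𝓞 (Fp L))) → (UnitaryGroup.localPi L (IsCMField.complexConj L) (2 + 2) (hermD L e dV hdV dW hdW) v → ℂ))
    (hb : ∀ i, ∀ v ∈ S₀, ∀ s : ℂ, (fun u => ((modDelta L e dV hdV dW hdW (𝒦.pPart (locToAdelic L e dV hdV dW hdW v u)) : ℝ) : ℂ) ^ (2 * (s - s₀)) * b i v u) ∈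
      localDegPS (Fp L) L (IsCMField.complexConj L) (complexConj_imagUnit L) (imagUnit_ne_zero L) (imagUnit_mul_self L)
        v 2 (gramR_isSymm L e dV hdV dW hdW) (hermD_eq_map_gramD L e dV hdV dW hdW) (fun w => χ.localComponent w.1) s)
    (FvT : Fin m → ∀ (S : skewMatrices ((IsCMField.complexConj L : L ≃ₐ[Fp L] L) : L →+* L) ((gramR L e dV hdV dW hdW).map (algebraMap (Fp L) L)))
      (h : HA L e dV hdV dW hdW) (v : (kindWFinset L e dV hdV dW hdW T₀ (S : Matrix (Fin 2) (Fin 2) L) h)),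
      ℂ → UnitaryGroup.localPi L (IsCMField.complexConj L) (2 + 2) (hermD L e dV hdV dW hdW) v.1 → ℂ)
    (hread : ∀ (j : Fin m) (S : skewMatrices ((IsCMField.complexConj L : L ≃ₐ[Fp L] L) : L →+* L) ((gramR L e dV hdV dW hdW).map (algebraMap (Fp L) L)))
      (h : HA L e dV hdV dW hdW) (v : (kindWFinset L e dV hdV dW hdW T₀ (S : Matrix (Fin 2) (Fin 2) L) h)) (s : ℂ)
      (y : UnitaryGroup.localPi L (IsCMField.complexConj L) (2 + 2) (hermD L e dV hdV dW hdW) v.1),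
      FvT j S h v s y = if v.1 ∈ S₀ then ((modDelta L e dV hdV dW hdW (𝒦.pPart (locToAdelic L e dV hdV dW hdW v.1 y)) : ℝ) : ℂ) ^ (2 * (s - s₀)) * b j v.1 y
        else LambdaLoc L e dV hdV dW hdW v.1 χ s y)
    (hintArch : ∀ (S : skewMatrices ((IsCMField.complexConj L : L ≃ₐ[Fp L] L) : L →+* L) ((gramR L e dV hdV dW hdW).map (algebraMap (Fp L) L))) (h : HA L e dV hdV dW hdW)
      (s : ℂ) (j : Fin m), ((2 : ℕ) : ℝ) / 2 < s.re → (S : Matrix (Fin 2) (Fin 2) L).det ≠ 0 →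
      Integrable (fun a : ↥(unipDeltaArch L e dV hdV dW hdW) =>
        conj (unipDeltaChar L e dV hdV dW hdW (S : Matrix (Fin 2) (Fin 2) L)
            (UnitaryGroup.archToAdelic (Fp L) L (IsCMField.complexConj L) (2 + 2) (hermD L e dV hdV dW hdW)
              (a : UnitaryGroup.arch (Fp L) L (IsCMField.complexConj L) (2 + 2) (hermD L e dV hdV dW hdW))) : ℂ) *
          FinfT j S h s (UnitaryGroup.archPart (Fp L) L (IsCMField.complexConj L) (2 + 2) (hermD L e dV hdV dW hdW) (SiegelDoubled.weylDelta L e dV hdV dW hdW) *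
              (a : UnitaryGroup.arch (Fp L) L (IsCMField.complexConj L) (2 + 2) (hermD L e dV hdV dW hdW)) *
              UnitaryGroup.archPart (Fp L) L (IsCMField.complexConj L) (2 + 2) (hermD L e dV hdV dW hdW) h))
        (νinf (kindWFinset L e dV hdV dW hdW T₀ (S : Matrix (Fin 2) (Fin 2) L) h))) :
    ∀ (S : skewMatrices ((IsCMField.complexConj L : L ≃ₐ[Fp L] L) : L →+* L) ((gramR L e dV hdV dW hdW).map (algebraMap (Fp L) L))) (h : HA L e dV hdV dW hdW) (s : ℂ) (j : Fin m),
      ((2 : ℕ) : ℝ) / 2 < s.re → (S : Matrix (Fin 2) (Fin 2) L).det ≠ 0 →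
      Integrable (fun p : ↥(unipDeltaArch L e dV hdV dW hdW) × (Π v : (kindWFinset L e dV hdV dW hdW T₀ (S : Matrix (Fin 2) (Fin 2) L) h), ↥(unipDeltaLoc L e dV hdV dW hdW v.1)) =>
      (conj (unipDeltaChar L e dV hdV dW hdW (S : Matrix (Fin 2) (Fin 2) L)
            (UnitaryGroup.archToAdelic (Fp L) L (IsCMField.complexConj L) (2 + 2) (hermD L e dV hdV dW hdW)
              (p.1 : UnitaryGroup.arch (Fp L) L (IsCMField.complexConj L) (2 + 2) (hermD L e dV hdV dW hdW))) : ℂ) *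
          ∏ v : (kindWFinset L e dV hdV dW hdW T₀ (S : Matrix (Fin 2) (Fin 2) L) h), conj (unipDeltaChar L e dV hdV dW hdW (S : Matrix (Fin 2) (Fin 2) L)
            (locToAdelic L e dV hdV dW hdW v.1
              ((p.2 v : ↥(unipDeltaLoc L e dV hdV dW hdW v.1)) : UnitaryGroup.localPi L (IsCMField.complexConj L) (2 + 2) (hermD L e dV hdV dW hdW) v.1)) : ℂ)) *
        (FinfT j S h s (UnitaryGroup.archPart (Fp L) L (IsCMField.complexConj L) (2 + 2) (hermD L e dV hdV dW hdW) (SiegelDoubled.weylDelta L e dV hdV dW hdW) *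
              (p.1 : UnitaryGroup.arch (Fp L) L (IsCMField.complexConj L) (2 + 2) (hermD L e dV hdV dW hdW)) *
              UnitaryGroup.archPart (Fp L) L (IsCMField.complexConj L) (2 + 2) (hermD L e dV hdV dW hdW) h) *
          ∏ v : (kindWFinset L e dV hdV dW hdW T₀ (S : Matrix (Fin 2) (Fin 2) L) h), FvT j S h v s (UnitaryGroup.evalPlace (Fp L) L (IsCMField.complexConj L) (2 + 2) (hermD L e dV hdV dW hdW) v.1
                (UnitaryGroup.finPart (Fp L) L (IsCMField.complexConj L) (2 + 2) (hermD L e dV hdV dW hdW) (SiegelDoubled.weylDelta L e dV hdV dW hdW)) *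
              ((p.2 v : ↥(unipDeltaLoc L e dV hdV dW hdW v.1)) : UnitaryGroup.localPi L (IsCMField.complexConj L) (2 + 2) (hermD L e dV hdV dW hdW) v.1) *
              UnitaryGroup.evalPlace (Fp L) L (IsCMField.complexConj L) (2 + 2) (hermD L e dV hdV dW hdW) v.1
                (UnitaryGroup.finPart (Fp L) L (IsCMField.complexConj L) (2 + 2) (hermD L e dV hdV dW hdW) h))))
        ((νinf (kindWFinset L e dV hdV dW hdW T₀ (S : Matrix (Fin 2) (Fin 2) L) h)).prod
          (Measure.pi fun v : (kindWFinset L e dV hdV dW hdW T₀ (S : Matrix (Fin 2) (Fin 2) L) h) => νv v.1)) :=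
  hint_of_isLocalSiegelSection_joint L e dV hdV dW hdW hdV0 hdW0 T₀ νinf νv hχu FinfT FvT hintArch
    (hsec_of_reading L e dV hdV dW hdW 𝒦 s₀ hχS₀ b hb FvT hread) (hsm_of_reading L e dV hdV dW hdW 𝒦 s₀ hχS₀ b hb FvT hread)

end Joint

end Summit.HodgeConjecture.HodgeConjecture.Cruxes.HLiu418.K2LiuKindWFactorLetters

end
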